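import Summits.BirchSwinnertonDyer.Rank1Residual.Additive.X4RankOneKimCornerThree
import Summits.BirchSwinnertonDyer.Rank1Residual.Additive.X4RankOneKimResidue
import Summits.BirchSwinnertonDyer.Rank1Residual.Additive.TypeGThreeTowerOfSurj
import HarnessLib

/-!
# X4 ∧ `r_an = 1`, `p = 3`, the O7-ord HALF: the rank-one corner WITHOUT a tower certificate — on
# (M) ∪ (G) rows the 3-adic tower is n1011-p14's THEOREM from surj(3) (cell `b2b-bsdres`, team n1011,
# sub-target T-a2r1c — FILE 3c, sibling of `Additive/X4RankOneKimCornerThree.lean`; binder DISCHARGE only)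

HONEST FRAMING (cell `b2b-bsdres`, run/shared/lean/b2b/bsd-rank1-residual/, verbatim in every
file): the goal of the cell is to DELETE the COMBINATION-SHAPED residual classes of the
Birch–Swinnerton-Dyer formula for ALL analytic-rank `≤ 1` elliptic curves over `ℚ` — "full BSD
formula for every rank `≤ 1` curve in class `C`" assembled STRICTLY from published theorems — so
that the rank-`≤ 1` remainder becomes exactly the CONSTRUCTION-SHAPED classes, which are TYPED
(missing-input `Prop`s), NOT attempted. This is not "finishing BSD". Team n1011: prove what is
provable now; shrink each hard class to its core with data; no claim beyond stated classes;
research routes; census output = EVIDENCE / conjecture items, never a Literature fact; RESIDUAL-MAP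
marks change only by signed lines. X4 stays CONSTRUCTION-SHAPED; §I O7 / N10 stay as marked; nothing
here is booked. Theorems only (NO definition, NO Literature fact, NO `_holds`); every conjecture and
every published input is an explicit hypothesis; `#print axioms` standard.

COVERAGE (stated first, referee 1 proviso): per pair, `p = 3`, `W/ℚ` globally minimal, `ClassX4 W 3`,
`ρ̄_{E,3}` onto, analytic rank `1`, and the row on the O7-ord half: Kodaira type `I₀*` at `3`
(`TypeG W 3`, in particular `ClassX4Gord W 3`) or potentially multiplicative (`ord₃ j < 0`, in
particular `ClassX4M W 3`) — there `∀ n, ρ̄_{E,3ⁿ}` onto is n1011-p14's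
`ClassX4.towerSurj_three_of_surj_of_typeG_or_potMult` (p251574; Wuthrich's Lemma 20 = A9, a tree
THEOREM, inside), so the `j`-witness / surj(9) certificate `hcert` of FILES 2 / 3b / 4 is DISCHARGED on
the whole O7-ord half (3 585 rows: (M) 3 009 + Gord3 576; p17 split of record 2026-08-21). Remaining
hypotheses unchanged and explicit: `X4SharpThreeKimRankOnePartial`, `X4.KimTamagawaDefectGeAt W 3 D.f`
(resp. `KimTamagawaDefectAt`), the Kurihara-number certificate, the datum, and in the compositions
`Delbourgo2002.mainTheorem_three` / `mainTheorem_potMult` + `CycLowerBoundAt W 3 Dh` + rider (+ `¬ CM`,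
non-anomalous on Gord3). The O7-ss half keeps `hcert` (its tower is a per-pair certificate or T-b9).

References: [Kim2022StructureSelmer] Thm. 1.9 (6), Conj. 1.10 (PDF p. 8); [Wuthrich2014] Cor. 19,
Lemma 20 (p. 399); [Delbourgo2002] Thm. (A), (B) (p. 40); [Miller2011LMS] Def. 1.1; cell files
cells/n1011/OWNERS.md (T-a2r1c, T-b1, T-O7), HOME/b2b-bsdres-n1011-p17/census/o7ord_x4at3_r1_split.tsv.
-/

noncomputable section

open scoped Classical MatrixGroups ModularForm NumberField

open CongruenceSubgroup WeierstrassCurve Literature.NumberTheory.EllipticCurves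
  Literature.NumberTheory.EllipticCurves.ModularForms
  Literature.NumberTheory.EllipticCurves.Rank1Residual
  Literature.NumberTheory.EllipticCurves.Rank1Residual.Typed
  Literature.NumberTheory.EllipticCurves.Delbourgo2002

namespace Summit.BirchSwinnertonDyer.Rank1Residual.Additive

section OrdHalf

variable (W : WeierstrassCurve ℚ) [W.IsElliptic] [W.IsGloballyMinimal]

/-- **O7-ord ∩ X4@3, rank one, NO tower certificate: `BSD(E,3) ↔ MissingLowerBoundAt W 3`** under the
hypotheses of `X4RankOne.bsdp_three_iff_lower_of_partial_of_tamagawaDefectGe_of_cert` with `hcert`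
REPLACED by the row predicate `TypeG W 3 ∨ ord₃ j(E) < 0` (tower = p14's theorem from surj(3)).
Per pair; nothing booked. [cite: Kim2022StructureSelmer, Thm. 1.9 (6), Conj. 1.10 (PDF p. 8)]
[cite: Wuthrich2014, Cor. 19 and Lemma 20 (p. 399)] [cite: Miller2011LMS, Def. 1.1] -/
theorem X4RankOne.bsdp_three_iff_lower_of_partial_of_tamagawaDefectGe_of_cert_of_typeG_or_potMult
    (h3 : X4SharpThreeKimRankOnePartial) (hGZK : rank_eq_analyticRank_of_analyticRank_le_one)
    (hmod : hasEntireLFunction_rat) (hX : ClassX4 W 3) (hsurj : Surj W 3)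
    (hGM : TypeG W 3 ∨ padicValRat 3 W.j < 0)
    (hr : W.analyticRank = 1) {q : ℚ} (hq : shaAn W = (q : ℂ)) (s : ℕ) (hs : (s : ℤ) ≤ padicValRat 3 q)
    {N : ℕ} [NeZero N] (D : ModularParametrizationData W N) (hc : ¬ (3 : ℤ) ∣ D.maninConstant)
    (hper : ∃ u : ℚ, ‖(u : ℚ_[3])‖ = 1 ∧ W.realPeriodRat = u * plusPeriod D.f)
    (hGe : X4.KimTamagawaDefectGeAt W 3 D.f)
    (ℓ : ℕ) [Fact ℓ.Prime] (hℓ : Kato.IsKolyvaginPrime W 3 (padicValNat 3 W.tamagawaProduct + s + 1) ℓ)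
    (hcyc : Nat.card {P : ((WeierstrassCurve.integralModelInt W).map
        (Int.castRingHom (ZMod ℓ))).toAffine.Point // 3 • P = 0} ≤ 3)
    (ψ : (ℓ' : ℕ) → (ZMod ℓ')ˣ →* Multiplicative (ZMod (3 ^ (padicValNat 3 W.tamagawaProduct + s + 1))))
    (hψ : Function.Surjective (ψ ℓ))
    (hδ : kuriharaNumber D.f (3 ^ (padicValNat 3 W.tamagawaProduct + s + 1)) ℓ ψ ≠ 0) :
    BSDp W 3 ↔ MissingLowerBoundAt W 3 :=
  bsdp_iff_missingLowerBoundAt_of_partial_of_tamagawaDefectGe_of_cert W 3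
    (kimRankOnePartialAt_three_of_classX4 W h3 hX) hGZK hmod hsurj
    (ClassX4.towerSurj_three_of_surj_of_typeG_or_potMult hX hGM hsurj) hr D (by exact_mod_cast hc) hper
    hGe hq s hs ℓ hℓ hcyc ψ hψ hδ

/-- **X4♯(G-ord)@3 ∧ `r_an = 1`, SHA row, NO tower certificate**: `BSD(E,3)` from {`∂`-clause@3,
Conj. 1.10 `≥`, `CycLowerBoundAt`@3} + ONE Kurihara number, as in
`ClassX4Gord.bsdp_three_rankOne_of_partial_of_cert_of_cycLowerBound` with `hcert` DISCHARGED
(`ClassX4Gord ⟹ TypeG`). Per pair; NOT a class theorem; nothing booked.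
[cite: Kim2022StructureSelmer, Thm. 1.9 (6), Conj. 1.10 (PDF p. 8)] [cite: Delbourgo2002, Theorem (A), (B) (p. 40), Hypothesis (p. 39)]
[cite: Wuthrich2014, Cor. 19 and Lemma 20 (p. 399)] [cite: Miller2011LMS, Def. 1.1] -/
theorem ClassX4Gord.bsdp_three_rankOne_of_partial_of_cert_of_cycLowerBound_towerFree
    (h3 : X4SharpThreeKimRankOnePartial) (hDel3 : Delbourgo2002.mainTheorem_three)
    (hGZK : rank_eq_analyticRank_of_analyticRank_le_one) (hmod : hasEntireLFunction_rat)
    (hX : ClassX4Gord W 3) (hcm : ¬ W.HasCM) (hna : ReductionNonAnomalous W 3)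
    (hlow : ∀ Dh : PAdicHeightData W 3, LeadingTermClauses W 3 Dh →
      SchneiderConjecture Dh ∧ CycLowerBoundAt W 3 Dh)
    (hsurj : Surj W 3) (hr : W.analyticRank = 1) {q : ℚ} (hq : shaAn W = (q : ℂ)) (s : ℕ)
    (hs : (s : ℤ) ≤ padicValRat 3 q)
    {N : ℕ} [NeZero N] (D : ModularParametrizationData W N) (hc : ¬ (3 : ℤ) ∣ D.maninConstant)
    (hper : ∃ u : ℚ, ‖(u : ℚ_[3])‖ = 1 ∧ W.realPeriodRat = u * plusPeriod D.f)
    (hGe : X4.KimTamagawaDefectGeAt W 3 D.f)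
    (ℓ : ℕ) [Fact ℓ.Prime] (hℓ : Kato.IsKolyvaginPrime W 3 (padicValNat 3 W.tamagawaProduct + s + 1) ℓ)
    (hcyc : Nat.card {P : ((WeierstrassCurve.integralModelInt W).map
        (Int.castRingHom (ZMod ℓ))).toAffine.Point // 3 • P = 0} ≤ 3)
    (ψ : (ℓ' : ℕ) → (ZMod ℓ')ˣ →* Multiplicative (ZMod (3 ^ (padicValNat 3 W.tamagawaProduct + s + 1))))
    (hψ : Function.Surjective (ψ ℓ))
    (hδ : kuriharaNumber D.f (3 ^ (padicValNat 3 W.tamagawaProduct + s + 1)) ℓ ψ ≠ 0) : BSDp W 3 :=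
  (X4RankOne.bsdp_three_iff_lower_of_partial_of_tamagawaDefectGe_of_cert_of_typeG_or_potMult W h3 hGZK
    hmod hX.1 hsurj (Or.inl hX.typeGOrd.typeG) hr hq s hs D hc hper hGe ℓ hℓ hcyc ψ hψ hδ).mpr
    (hX.missingLowerBoundAt_three_rankLeOne_of_cycLowerBound hDel3 hGZK hcm (by rw [hr]) hna hlow)

end OrdHalf

end Summit.BirchSwinnertonDyer.Rank1Residual.Additive

namespace Summit.BirchSwinnertonDyer.Rank1Residual.AdditivePotMult

open Summit.BirchSwinnertonDyer.Rank1Residual.Additive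

variable (W : WeierstrassCurve ℚ) [W.IsElliptic] [W.IsGloballyMinimal]

/-- **X4(M)@3 ∧ `r_an = 1`, SHA row, NO tower certificate**: `BSD(E,3)` from {`∂`-clause@3, Conj. 1.10
`≥`, `CycLowerBoundAt`@3} + ONE Kurihara number, as in
`ClassX4M.bsdp_three_rankOne_of_partial_of_cert_of_cycLowerBound` with `hcert` DISCHARGED
(`ClassX4M ⟹ ord₃ j < 0`). Per pair; NOT a class theorem; nothing booked.
[cite: Kim2022StructureSelmer, Thm. 1.9 (6), Conj. 1.10 (PDF p. 8)] [cite: Delbourgo2002, Theorem (A), (B) (p. 40), Hypothesis (p. 39)]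
[cite: Wuthrich2014, Cor. 19 and Lemma 20 (p. 399)] [cite: Miller2011LMS, Def. 1.1] -/
theorem ClassX4M.bsdp_three_rankOne_of_partial_of_cert_of_cycLowerBound_towerFree
    (h3 : X4SharpThreeKimRankOnePartial) (hDelM : Delbourgo2002.mainTheorem_potMult)
    (hGZK : rank_eq_analyticRank_of_analyticRank_le_one) (hmod : hasEntireLFunction_rat)
    (hX : ClassX4M W 3)
    (hlow : ∀ Dh : PAdicHeightData W 3, LeadingTermClauses W 3 Dh →
      SchneiderConjecture Dh ∧ CycLowerBoundAt W 3 Dh)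
    (hsurj : Surj W 3) (hr : W.analyticRank = 1) {q : ℚ} (hq : shaAn W = (q : ℂ)) (s : ℕ)
    (hs : (s : ℤ) ≤ padicValRat 3 q)
    {N : ℕ} [NeZero N] (D : ModularParametrizationData W N) (hc : ¬ (3 : ℤ) ∣ D.maninConstant)
    (hper : ∃ u : ℚ, ‖(u : ℚ_[3])‖ = 1 ∧ W.realPeriodRat = u * plusPeriod D.f)
    (hGe : X4.KimTamagawaDefectGeAt W 3 D.f)
    (ℓ : ℕ) [Fact ℓ.Prime] (hℓ : Kato.IsKolyvaginPrime W 3 (padicValNat 3 W.tamagawaProduct + s + 1) ℓ)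
    (hcyc : Nat.card {P : ((WeierstrassCurve.integralModelInt W).map
        (Int.castRingHom (ZMod ℓ))).toAffine.Point // 3 • P = 0} ≤ 3)
    (ψ : (ℓ' : ℕ) → (ZMod ℓ')ˣ →* Multiplicative (ZMod (3 ^ (padicValNat 3 W.tamagawaProduct + s + 1))))
    (hψ : Function.Surjective (ψ ℓ))
    (hδ : kuriharaNumber D.f (3 ^ (padicValNat 3 W.tamagawaProduct + s + 1)) ℓ ψ ≠ 0) : BSDp W 3 :=
  (X4RankOne.bsdp_three_iff_lower_of_partial_of_tamagawaDefectGe_of_cert_of_typeG_or_potMult W h3 hGZK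
    hmod hX.classX4 hsurj (Or.inr hX.potMult.2) hr hq s hs D hc hper hGe ℓ hℓ hcyc ψ hψ hδ).mpr
    (hX.missingLowerBoundAt_rankLeOne_of_cycLowerBound hDelM hGZK (by rw [hr]) hlow)

end Summit.BirchSwinnertonDyer.Rank1Residual.AdditivePotMult


/-! ## APPEND (same seat, same session): the NAMED-RESIDUE form (FILE 4) on the O7-ord half, tower-free -/

namespace Summit.BirchSwinnertonDyer.Rank1Residual.Additive

variable (W : WeierstrassCurve ℚ) [W.IsElliptic] [W.IsGloballyMinimal]

/-- **O7-ord ∩ X4@3, rank one, NO tower certificate: the residue NAMED** —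
`BSD(E,3) ↔ ∃ m, ord₃ #Ш_an = m ∧ ∂^{(1)}(δ̃) = m + ord₃ ∏c` modulo `X4SharpThreeKimRankOnePartial`, Kim's
Conjecture 1.10 at the pair and `∂^{(1)} ≠ ∞` (FILE 4's
`X4RankOne.bsdp_three_iff_exists_partial_eq_of_partial_of_tamagawaDefect` with `hcert` replaced by the row
predicate `TypeG W 3 ∨ ord₃ j(E) < 0`; tower = p14's theorem from surj(3)). Per pair; nothing booked.
[cite: Kim2022StructureSelmer, Thm. 1.9 (6), Conj. 1.10 (PDF p. 8)] [cite: Wuthrich2014, Cor. 19 and Lemma 20 (p. 399)]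
[cite: Miller2011LMS, Def. 1.1] -/
theorem X4RankOne.bsdp_three_iff_exists_partial_eq_of_partial_of_tamagawaDefect_of_typeG_or_potMult
    (h3 : X4SharpThreeKimRankOnePartial) (hGZK : rank_eq_analyticRank_of_analyticRank_le_one)
    (hmod : hasEntireLFunction_rat) (hX : ClassX4 W 3) (hsurj : Surj W 3)
    (hGM : TypeG W 3 ∨ padicValRat 3 W.j < 0) (hr : W.analyticRank = 1)
    {N : ℕ} [NeZero N] (D : ModularParametrizationData W N) (hc : ¬ (3 : ℤ) ∣ D.maninConstant)
    (hper : ∃ u : ℚ, ‖(u : ℚ_[3])‖ = 1 ∧ W.realPeriodRat = u * plusPeriod D.f)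
    (hne : kuriharaPartial W 3 D.f 1 ≠ ⊤) (hT : X4.KimTamagawaDefectAt W 3 D.f)
    {q : ℚ} (hq : shaAn W = (q : ℂ)) :
    BSDp W 3 ↔
      ∃ m : ℕ, padicValRat 3 q = m ∧
        ((m + padicValNat 3 W.tamagawaProduct : ℕ) : ℕ∞) = kuriharaPartial W 3 D.f 1 :=
  bsdp_iff_exists_partial_eq_of_kimRankOnePartialAt_of_tamagawaDefect W 3
    (kimRankOnePartialAt_three_of_classX4 W h3 hX) hGZK hmod hsurj
    (ClassX4.towerSurj_three_of_surj_of_typeG_or_potMult hX hGM hsurj) hr D (by exact_mod_cast hc) hper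
    hne hT hq

end Summit.BirchSwinnertonDyer.Rank1Residual.Additive

end
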